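import Summits.ABC.IUTFork.Joshi.GeometricCaseCoverModel
import Summits.ABC.IUTFork.Joshi.GeometricCaseBridge
import HarnessLib

/-!
# [J-III] §12: E-t36's `HeightDatum` (§§12.9–12.18 signature) is INHABITED — over the model of (12.3.1)

Block E of the abc-iut cell (rung LADDER-ABC:A2.E), seat abc-iut-E-t53 (batch 3; companion of `Joshi/GeometricCaseCoverModel.lean`,
p433554). PROOF/MODEL file over `Joshi/GeometricCaseCoverModel.lean` (the automorphy-factor model `coverModel : CoverSL2R _` of the
universal cover `S̃L₂(ℝ)`, (12.3.1) PROVED there) and E-t36's bridge `Joshi/GeometricCaseBridge.lean` (`GeoLocus.HeightDatum.ofCover` —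
the §§12.9–12.18 signature from a `CoverSL2R`, a `Level` and a height function; consumed BY NAME, nothing restated). No claim-`Prop`,
no `Prop` fact, no instance, no `sorry`.

SOURCE. K. Joshi, arXiv:2401.13508**v4** (unrefereed; bib `Joshi2024ATS3`), §12.3 (12.3.1) p.146 l.26–32; §12.8 p.149 l.32–34
(«Let `ℓ ≥ 5` be a prime number, let `ℓ* = (ℓ−1)/2`»); §12.13 p.154 l.1–10 (the height `h` «defined in [Zhang, 2001, Proof of
Theorem 3.3]»); (12.14.1) p.154 l.13–14; Thm. 12.18.1 p.156 l.29–49.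

CONTENT.
* `levelFive` — a `Geo.Level` exists (`ℓ = 5`).
* `heightDatumModel L h := HeightDatum.ofCover coverModel L h` — E-t36's carrier over the MODEL, for every level and every height
  function; `nonempty_heightDatum`, `nonempty_heightDatum_model`: **`GeoLocus.HeightDatum` is inhabited** (E-t36's module docstring
  recorded «NOT here: … a model of `S̃L₂(ℝ)`»).
* `heightSubadditive_zero` — the ZERO height satisfies E-t36's hypothesis-`Prop` (12.14.1) `HeightSubadditive` (degenerate instance:
  the genuine `h` is [Zhang 2001]'s and is not constructed here or in print), hence `thm12181Reading_model_zero`: the hypotheses of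
  E-t36's DERIVED form of Thm. 12.18.1 (`thm12181Reading_of_subadditive` / E-t36's `thm12181Reading_ofCover`) are jointly satisfiable
  on an honest `S̃L₂(ℝ)`-model — a NON-VACUITY witness for the X-04-GEO row (cx-2 TEST-LEDGER-cx2), nothing more.
FRAMING: no side is taken on [IUTchIII] Cor. 3.12, on Joshi's claims or on any author; a model exhibits satisfiability of a typed
interface, nothing more; typed ≠ proved ≠ endorsed; nothing here bears on abc.
-/

noncomputable section

open scoped MatrixGroups UpperHalfPlane

namespace Summit.ABC.IUTFork.Joshi.ATS3.Geo

/-- A level exists: `ℓ = 5` (prime, `≥ 5`; then `ℓ* = 2`). [folklore] -/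
def levelFive : Level where
  ell := 5
  prime := Nat.prime_five
  five_le := le_rfl

/-- `ℓ* = 2` at level `5`. -/
theorem levelFive_lstar : levelFive.lstar = 2 := rfl

/-- **E-t36's `HeightDatum` over the model of `S̃L₂(ℝ)`**: the §§12.9–12.18 signature (E-t36, p430006) built by E-t36's bridge
`HeightDatum.ofCover` from the automorphy-factor model `coverModel` ((12.3.1) PROVED, p433554), a level `L` and a height function
`h` (§12.13: a parameter, [Zhang 2001]). [folklore] -/
def heightDatumModel (L : Level) (h : CoverModel.Cover → ℝ) : GeoLocus.HeightDatum CoverModel.Cover :=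
  GeoLocus.HeightDatum.ofCover coverModel L h

/-- Its projection is the model's covering map (definitionally). -/
theorem heightDatumModel_proj (L : Level) (h : CoverModel.Cover → ℝ) : (heightDatumModel L h).proj = CoverModel.proj := rfl

/-- Its `φ_∞` is the model's `z²` = the deck translation `(τ, w) ↦ (τ, w + 2πi)` (`coe_phi_coverModel`). -/
theorem heightDatumModel_frob (L : Level) (h : CoverModel.Cover → ℝ) : (heightDatumModel L h).frob = coverModel.phi := rfl

/-- NON-VACUITY of E-t36's carrier at every level (e.g. with the zero height). -/
theorem nonempty_heightDatum (L : Level) : Nonempty (GeoLocus.HeightDatum CoverModel.Cover) := ⟨heightDatumModel L 0⟩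

/-- **`GeoLocus.HeightDatum` is inhabited** (level `5`, zero height, over the model of (12.3.1)). -/
theorem nonempty_heightDatum_model : Nonempty (GeoLocus.HeightDatum CoverModel.Cover) := nonempty_heightDatum levelFive

/-- Degenerate instance of E-t36's hypothesis-`Prop` (12.14.1): the ZERO height is subadditive. (The genuine height is
[Zhang 2001]'s; nothing about it is asserted.) [folklore] -/
theorem heightSubadditive_zero (L : Level) : (heightDatumModel L 0).HeightSubadditive :=
  (GeoLocus.HeightDatum.heightSubadditive_ofCover_iff coverModel L 0).mpr fun _ _ => by simp

/-- Degenerate instance of E-t36's hypothesis-`Prop` (12.15.1): the ZERO height satisfies the log-link bound `0 ≤ 0 + π·m` only for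
`m ≥ 0` — so (12.15.1) as typed (all `m : ℤ`) FAILS for the zero height: `HeightLogLinkBound` is a genuine constraint on `h`, not a
tautology (recorded so that the zero-height witness is not over-read). [folklore] -/
theorem not_heightLogLinkBound_zero (L : Level) : ¬(heightDatumModel L 0).HeightLogLinkBound := by
  rw [heightDatumModel, GeoLocus.HeightDatum.heightLogLinkBound_ofCover_iff]
  intro h
  have h1 := h 1 (-1)
  simp only [Pi.zero_apply, Int.cast_neg, Int.cast_one, mul_neg, mul_one, zero_add] at h1
  linarith [Real.pi_pos]

/-- **Non-vacuity of the hypotheses of E-t36's DERIVED Thm. 12.18.1 (OUR READING)** on an honest `S̃L₂(ℝ)`-model: with the zero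
height, for every domain locus and every monodromy datum with `S ≠ ∅`, `Thm12181Reading` holds (via E-t36's
`thm12181Reading_ofCover`). A satisfiability witness for the X-04-GEO row, nothing more. [folklore] -/
theorem thm12181Reading_model_zero (L : Level) {Pi : Type} [Group Pi] {genus n : ℕ} (hn : 0 < n)
    (Lc : (heightDatumModel L 0).DomainLocus n) (M : GeoLocus.MonodromyDatum Pi genus n) :
    (heightDatumModel L 0).Thm12181Reading Lc M :=
  GeoLocus.HeightDatum.thm12181Reading_ofCover coverModel L 0 (heightSubadditive_zero L) hn Lc M

end Summit.ABC.IUTFork.Joshi.ATS3.Geo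

end
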